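import Summits.BirchSwinnertonDyer.Rank1Residual.Additive.X3BranchAlgebraicCountWOfLifting
import Summits.BirchSwinnertonDyer.Rank1Residual.Additive.X3BranchMainConjectureGordOfFacts
import Summits.BirchSwinnertonDyer.Rank1Residual.X2.GreenbergVatsalCaseOne
import HarnessLib

/-!
# X3 on the semistable-twist locus, cell (G-ord, `e = 2`) AT `p = 3` (and every odd `p`): the
# `W`-level branch MAIN CONJECTURE, `CycLowerLeadingTermAt`, `MissingLowerBoundAt W 3` and `BSD(E,3)`
# from PUBLISHED named facts + the per-pair line datum + ONE DISPLAYED input, the residual LIFTING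
# for an even line UNRAMIFIED at `p` (cell `bsd-addord`, seat `bsd-addord-twist`, strategy = twist
# transport; sequel of `X3BranchAlgebraicCountWOfLifting.lean` / `X3BranchGordEndStateOfFacts.lean`)

HONEST FRAMING (cell `bsd-addord`, `run/shared/lean/pub/bsd-addord/README.md` §4): the programme's
target of record is the full Birch–Swinnerton-Dyer formula for every `E/ℚ` of analytic rank `≤ 1`;
this file concerns the X3 rows (`E[p]` reducible) of cell (G-ord, `e = 2`) of N10, in particular the
NON-DEGENERATE `p = 3` rows (`χφ_V ≠ 1`; census v2: 1 434 classes, 685 of them `r_an = 0`) where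
the branch-parity line `Φ₀` is UNRAMIFIED at `3`. THEOREMS ONLY (no `def`, no named fact, no
`sorry`). The published inputs are displayed named facts (`hW16`, `hGV`, `h23`, `h414`, `hGrK`,
`hDel3`, `hDel98`, `hGZK`, `hmod`, `hmodD`); ONE input is DISPLAYED as a hypothesis in the Literature
vocabulary, `hlift` = the residual lifting "every class of `U ⊂ H¹(ℚ_Σ/ℚ_∞, W[3]/Φ₀)` lifts to
`H¹(ℚ_Σ/ℚ_∞, W[3])`" (GV 2000 p. 28, whose printed proof p. 30 — `H²(ℚ_Σ/ℚ_∞, Φ) = 0` "because `φ` is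
even", Ferrero–Washington + Prop. (2.5) + [Gre99] Prop. 4 — uses only the EVENNESS of `φ`; the tree's
reading-fact `residualEpsilon_surjOn_of_lineRamifiedEven` carries GV's standing "ramified" and so does
not serve here; the even-line reading is to be filed as a sibling Literature record, after which
`hlift` is discharged by one line). Nothing is booked by this file.

## What

* §1 `X3Branch.charIdeal_eq_span_of_facts_of_lifting`, `X3Branch.chiBranchLowerDivisibilityAt_of_facts_of_lifting`
  — the `W`-level branch main conjecture / the Λ-adic containment from `hW16 ∧ hGV ∧ h23 ∧ h414 ∧ hGrK`
  + the line datum (EVEN, non-trivial action, `χ`-twist ramified; NO ramification hypothesis) + `hlift`.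
* §2 `ClassX3Gord.chiBranchLowerLeadingTerm[Odd]At_of_facts_of_lifting`,
  `ClassX3Gord.cycLowerLeadingTermAt_of_facts_of_lifting` (every odd `p`).
* §3 **`ClassX3Gord.missingLowerBoundAt_three_rankZero_of_facts_of_lifting_of_nonAnomalous`**,
  **`ClassX3Gord.bsdp_three_rankZero_of_facts_of_lifting_of_nonAnomalous`** — `p = 3`.

References: [GreenbergVatsal2000] §2 (11), (16), pp. 28–30, §3 Thm. (3.12); [Wuthrich2014] Thm. 16;
[GreenbergLNM1716] Props. 2.2, 2.4, 4.14; [Delbourgo2002] (A), (B); [Delbourgo1998] Prop. 4; [Miller2011LMS] Def. 1.1.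
-/

set_option autoImplicit false

noncomputable section

open scoped Classical MatrixGroups ModularForm

namespace Summit.BirchSwinnertonDyer.Rank1Residual.Additive

open CongruenceSubgroup WeierstrassCurve NumberField IsDedekindDomain Field
  Literature.NumberTheory.EllipticCurves
  Literature.NumberTheory.EllipticCurves.ModularForms
  Literature.NumberTheory.EllipticCurves.GreenbergVatsal2000
  Literature.NumberTheory.EllipticCurves.Rank1Residual
  Literature.NumberTheory.EllipticCurves.Rank1Residual.Typed
  Literature.NumberTheory.GaloisRepresentations
  Summit.BirchSwinnertonDyer.Rank1Residual.X1.MuLambda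
  Summit.BirchSwinnertonDyer.Rank1Residual.AdditivePotMult
  Summit.BirchSwinnertonDyer.Rank1Residual.Additive.X3Branch

/-! ### §1 The `W`-level branch main conjecture with the lifting displayed -/

section OfFactsLifting

variable {V : WeierstrassCurve ℚ} [V.IsElliptic] [V.IsGloballyMinimal]
  {W : WeierstrassCurve ℚ} [W.IsElliptic] [W.IsGloballyMinimal] {p : ℕ} [hp : Fact p.Prime]

/-- **THE `W`-LEVEL BRANCH MAIN CONJECTURE OF THE ADDITIVE CURVE FROM PUBLISHED FACTS** (Delbourgo's
Main Conjecture (G) for `E = W` in Greenberg form, both parities, on the branch-parity line position).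
`V` GOOD ORDINARY at the odd `p`, `C • V^{(p*)} = W`; `Σ₀ ∌ p` finite with the bad places `≠ p`
inside; `Φ₀ ≤ W[p]` a rational line, EVEN, non-trivial `Γ_ℚ`-action, whose `χ_K`-twist is ramified
at `p` for every quadratic `K` with `θ² = p*`; `κ` cyclotomic, `γ` a topological generator matching the
cyclotomic variable, `f` the newform of `V`, `D` ANY `Λ`-dual datum of `Sel_{p^∞}(W/ℚ_∞)`, `ϖ` the
period ratio of the parity of `m = (p−1)/2`. THEN `X(W/ℚ_∞)` is `Λ`-torsion and
`char_Λ X(W/ℚ_∞) = (g')` with `ι g' = u·ϖ·L_p(f_V, α_V, ω^m, T)`, `u ∈ ℤ_pˣ` — GRANTED ONLY the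
PUBLISHED records `hW16` (Wuthrich Thm. 16), `hGV` (GV Thm. (3.12) on the branch), `h23` (GV Cor.
(2.3)/Prop. (2.4) at the datum), `h414` (Greenberg Prop. 4.14), `hGrK` (Greenberg Props. 2.2/2.4),
and the DISPLAYED residual lifting `hlift` (GV p. 28/30; the tree's reading-fact when `Φ₀` is
ramified at `p`); `Φ₀` carries a non-trivial `Γ_ℚ`-action (`hnt`), ramification at `p` NOT required.
`X3BranchMainConjectureGordOfFacts`'s twist descent composed with
`X3Branch.algebraicCountW_of_facts_of_lifting`.
[cite: Delbourgo1998, Main Conjecture (p. 151)] [cite: GreenbergVatsal2000, §2 (11), (16), pp. 26–30; §3 Thm. (3.12) p. 45]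
[cite: Wuthrich2014, Thm. 16 (p. 397)] [cite: GreenbergLNM1716, Props. 2.2, 2.4, 4.14; §5 p. 143] -/
theorem X3Branch.charIdeal_eq_span_of_facts_of_lifting
    (hW16 : Wuthrich2014.thm16_halfEigenCharIdeal_dvd_cyclotomicPrime)
    (hGV : thm312_branch_unitContent_and_lambda_eq_residual_goodOrd)
    (h23 : datumSelmer_nonPrimitive_invariants)
    (h414 : Greenberg1999.prop414_noFiniteSubmodule_of_not_dvd_torsionOrder)
    (hGrK : Greenberg1999.imKummer_ge_strictCondition_goodOrdinary)
    (hp2 : p ≠ 2) (hgood : GoodOrd V p) {C : VariableChange ℚ}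
    (hC : C • V.quadraticTwist ((-1) ^ (p / 2) * p : ℚ) = W)
    (S₀ : Finset (HeightOneSpectrum (𝓞 ℚ))) (hS₀ : ∀ v ∈ S₀, ((p : ℕ) : 𝓞 ℚ) ∉ v.asIdeal)
    (hS : ∀ v : HeightOneSpectrum (𝓞 ℚ), v ∉ S₀ → ((p : ℕ) : 𝓞 ℚ) ∉ v.asIdeal →
      W.HasGoodReductionAt v)
    (Φ₀ : AddSubgroup (W.geomTorsion (p : ℤ))) (hΦ : IsRationalLine W p Φ₀)
    (heven : LineEven W p Φ₀)
    (hnt : ∃ (σ : absoluteGaloisGroup ℚ) (P : W.geomTorsion (p : ℤ)), P ∈ Φ₀ ∧ σ • P ≠ P)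
    (hram : ∀ (K : Type) [Field K] [NumberField K] [(galRange (K := ℚ) K).Normal],
      Module.finrank ℚ K = 2 → (∃ θ : K, θ ^ 2 = algebraMap ℚ K ((-1) ^ (p / 2) * p)) →
      ¬ ∀ v : HeightOneSpectrum (𝓞 ℚ), ((p : ℕ) : 𝓞 ℚ) ∈ v.asIdeal →
        ∀ 𝔓 ∈ v.primesAbove, ∀ σ ∈ 𝔓.inertia (absoluteGaloisGroup ℚ), ∀ P ∈ Φ₀,
          σ • P = (if σ ∈ galRange (K := ℚ) K then P else -P))
    (hlift : ∀ (κ : ZpExtension ℚ p) (S₀ : Finset (HeightOneSpectrum (𝓞 ℚ))), κ.IsCyclotomic →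
      (∀ v ∈ S₀, ((p : ℕ) : 𝓞 ℚ) ∉ v.asIdeal) →
      (∀ v : HeightOneSpectrum (𝓞 ℚ), v ∉ S₀ → ((p : ℕ) : 𝓞 ℚ) ∉ v.asIdeal → W.HasGoodReductionAt v) →
      ∀ s ∈ residualQuotSelmer W p κ S₀ Φ₀ hΦ, ∃ x ∈ residualTorsionH1 W p κ S₀,
        residualEpsilon W p κ Φ₀ hΦ x = s)
    {κ : ZpExtension ℚ p} {γ : Field.absoluteGaloisGroup ℚ} {N : ℕ} [NeZero N]
    {f : CuspForm (Gamma0 N) 2}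
    (hκ : κ.IsCyclotomic) (hγ : κ.IsTopGenerator γ) (hcv : IsCyclotomicVariable p γ)
    (hf : IsNewformOf V f) (D : W.SelmerDualData κ γ) (ϖ : ℚ)
    (hϖ : if Even (p / 2) then (ϖ : ℝ) * V.realPeriodRat = plusPeriod f
        else (ϖ : ℝ) * V.imaginaryPeriodRat = minusPeriod f) :
    D.IsTorsion ∧ ∃ g' : IwasawaAlgebra p, D.charIdeal = Ideal.span {g'} ∧ ∃ u : ℤ_[p]ˣ,
      iwasawaToPowerSeries p g' =
        PowerSeries.C (((u : ℤ_[p]) : ℚ_[p]) * (ϖ : ℚ_[p])) *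
          (if Even (p / 2) then padicLFunctionBranch f ((unitRoot V p : ℤ_[p]) : ℚ_[p]) (p / 2)
            else padicLFunctionMinusBranch f ((unitRoot V p : ℤ_[p]) : ℚ_[p]) (p / 2)) :=
  X3Branch.charIdeal_eq_span_of_thm312_of_algebraicCountWT hW16 hGV hp2 hgood hC S₀ hS₀ hS Φ₀ hΦ heven
    hnt hram
    (fun D g hκ' hγ' hDt hg hμ ↦ X3Branch.algebraicCountW_of_facts_of_lifting h23 h414 hGrK hp2 V hgood
      hC S₀ hS₀ hS Φ₀ hΦ heven hnt hram (fun κ'' hκ'' ↦ hlift κ'' S₀ hκ'' hS₀ hS) D g hκ' hγ' hDt hg hμ)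
    hκ hγ hcv hf D ϖ hϖ

omit [V.IsElliptic] [V.IsGloballyMinimal] in
/-- **`p ≡ 1 (mod 4)`: the Λ-adic integral containment `ChiBranchLowerDivisibilityAt W p` FROM
PUBLISHED FACTS** + the line data + the displayed lifting (twin of
`X3Branch.chiBranchLowerDivisibilityAt_of_facts`). [cite: SkinnerUrban2014, Thm. 3.6.4 (p. 43) (shape only)]
[cite: GreenbergVatsal2000, §3 Thm. (3.12) p. 45] [cite: Wuthrich2014, Thm. 16 (p. 397)] -/
theorem X3Branch.chiBranchLowerDivisibilityAt_of_facts_of_lifting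
    (hW16 : Wuthrich2014.thm16_halfEigenCharIdeal_dvd_cyclotomicPrime)
    (hGV : thm312_branch_unitContent_and_lambda_eq_residual_goodOrd)
    (h23 : datumSelmer_nonPrimitive_invariants)
    (h414 : Greenberg1999.prop414_noFiniteSubmodule_of_not_dvd_torsionOrder)
    (hGrK : Greenberg1999.imKummer_ge_strictCondition_goodOrdinary)
    (S₀ : Finset (HeightOneSpectrum (𝓞 ℚ))) (hS₀ : ∀ v ∈ S₀, ((p : ℕ) : 𝓞 ℚ) ∉ v.asIdeal)
    (hS : ∀ v : HeightOneSpectrum (𝓞 ℚ), v ∉ S₀ → ((p : ℕ) : 𝓞 ℚ) ∉ v.asIdeal →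
      W.HasGoodReductionAt v)
    (Φ₀ : AddSubgroup (W.geomTorsion (p : ℤ))) (hΦ : IsRationalLine W p Φ₀)
    (heven : LineEven W p Φ₀)
    (hnt : ∃ (σ : absoluteGaloisGroup ℚ) (P : W.geomTorsion (p : ℤ)), P ∈ Φ₀ ∧ σ • P ≠ P)
    (hram : ∀ (K : Type) [Field K] [NumberField K] [(galRange (K := ℚ) K).Normal],
      Module.finrank ℚ K = 2 → (∃ θ : K, θ ^ 2 = algebraMap ℚ K ((-1) ^ (p / 2) * p)) →
      ¬ ∀ v : HeightOneSpectrum (𝓞 ℚ), ((p : ℕ) : 𝓞 ℚ) ∈ v.asIdeal →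
        ∀ 𝔓 ∈ v.primesAbove, ∀ σ ∈ 𝔓.inertia (absoluteGaloisGroup ℚ), ∀ P ∈ Φ₀,
          σ • P = (if σ ∈ galRange (K := ℚ) K then P else -P))
    (hlift : ∀ (κ : ZpExtension ℚ p) (S₀ : Finset (HeightOneSpectrum (𝓞 ℚ))), κ.IsCyclotomic →
      (∀ v ∈ S₀, ((p : ℕ) : 𝓞 ℚ) ∉ v.asIdeal) →
      (∀ v : HeightOneSpectrum (𝓞 ℚ), v ∉ S₀ → ((p : ℕ) : 𝓞 ℚ) ∉ v.asIdeal → W.HasGoodReductionAt v) →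
      ∀ s ∈ residualQuotSelmer W p κ S₀ Φ₀ hΦ, ∃ x ∈ residualTorsionH1 W p κ S₀,
        residualEpsilon W p κ Φ₀ hΦ x = s) :
    ChiBranchLowerDivisibilityAt W p := by
  intro V _ _ κ γ N _ f hp1 hCW hgood hκ hγ hcv hf D ϖ hϖ g hg
  have hp2 : p ≠ 2 := by omega
  have heven' : Even (p / 2) := ⟨p / 4, by omega⟩
  obtain ⟨C, hC⟩ := hCW
  have hC' : C • V.quadraticTwist ((-1) ^ (p / 2) * p : ℚ) = W := by
    rw [pStar_eq_self_of_mod_four_eq_one hp1]; exact hC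
  obtain ⟨-, g', hchar, u, hι⟩ := X3Branch.charIdeal_eq_span_of_facts_of_lifting hW16 hGV h23 h414 hGrK
    hp2 hgood hC' S₀ hS₀ hS Φ₀ hΦ heven hnt hram hlift hκ hγ hcv hf D ϖ (by rw [if_pos heven']; exact hϖ)
  rw [if_pos heven'] at hι
  have hg' : g ∈ Ideal.span ({g'} : Set (IwasawaAlgebra p)) := by rw [← hchar]; exact hg
  obtain ⟨a, rfl⟩ := Ideal.mem_span_singleton'.mp hg'
  refine ⟨PowerSeries.C (u : ℤ_[p]) * a, ?_⟩
  have hCu : PowerSeries.C ((((u : ℤ_[p]) : ℚ_[p])) * (ϖ : ℚ_[p])) =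
      PowerSeries.C (((u : ℤ_[p]) : ℚ_[p])) * PowerSeries.C (ϖ : ℚ_[p]) := map_mul _ _ _
  rw [map_mul, hι, iwasawaToPowerSeries_C_mul', hCu]
  ring

end OfFactsLifting

/-! ### §2 `T = 0` inputs and `CycLowerLeadingTermAt`, every odd `p`, lifting displayed -/

section EndStateLifting

variable {W : WeierstrassCurve ℚ} [W.IsElliptic] [W.IsGloballyMinimal] {p : ℕ} [hp : Fact p.Prime]

/-- **`p ≡ 1 (mod 4)`, type (G)-ordinary: the `T = 0` LOWER input `ChiBranchLowerLeadingTermAt W p`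
from PUBLISHED facts + the line data + the displayed lifting.** [cite: MazurTateTeitelbaum1986Invent, §I.14]
[cite: GreenbergVatsal2000, §3 Thm. (3.12) p. 45] [cite: Wuthrich2014, Thm. 16 (p. 397)] -/
theorem ClassX3Gord.chiBranchLowerLeadingTermAt_of_facts_of_lifting
    (hW16 : Wuthrich2014.thm16_halfEigenCharIdeal_dvd_cyclotomicPrime)
    (hGV : thm312_branch_unitContent_and_lambda_eq_residual_goodOrd)
    (h23 : datumSelmer_nonPrimitive_invariants)
    (h414 : Greenberg1999.prop414_noFiniteSubmodule_of_not_dvd_torsionOrder)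
    (hGrK : Greenberg1999.imKummer_ge_strictCondition_goodOrdinary)
    (hG : TypeGOrd W p)
    (Φ₀ : AddSubgroup (W.geomTorsion (p : ℤ))) (hΦ : IsRationalLine W p Φ₀)
    (heven : LineEven W p Φ₀)
    (hnt : ∃ (σ : absoluteGaloisGroup ℚ) (P : W.geomTorsion (p : ℤ)), P ∈ Φ₀ ∧ σ • P ≠ P)
    (hram : ∀ (K : Type) [Field K] [NumberField K] [(galRange (K := ℚ) K).Normal],
      Module.finrank ℚ K = 2 → (∃ θ : K, θ ^ 2 = algebraMap ℚ K ((-1) ^ (p / 2) * p)) →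
      ¬ ∀ v : HeightOneSpectrum (𝓞 ℚ), ((p : ℕ) : 𝓞 ℚ) ∈ v.asIdeal →
        ∀ 𝔓 ∈ v.primesAbove, ∀ σ ∈ 𝔓.inertia (absoluteGaloisGroup ℚ), ∀ P ∈ Φ₀,
          σ • P = (if σ ∈ galRange (K := ℚ) K then P else -P))
    (hlift : ∀ (κ : ZpExtension ℚ p) (S₀ : Finset (HeightOneSpectrum (𝓞 ℚ))), κ.IsCyclotomic →
      (∀ v ∈ S₀, ((p : ℕ) : 𝓞 ℚ) ∉ v.asIdeal) →
      (∀ v : HeightOneSpectrum (𝓞 ℚ), v ∉ S₀ → ((p : ℕ) : 𝓞 ℚ) ∉ v.asIdeal → W.HasGoodReductionAt v) →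
      ∀ s ∈ residualQuotSelmer W p κ S₀ Φ₀ hΦ, ∃ x ∈ residualTorsionH1 W p κ S₀,
        residualEpsilon W p κ Φ₀ hΦ x = s) :
    ChiBranchLowerLeadingTermAt W p := by
  obtain ⟨S₀, hS₀, hS⟩ := X2.GreenbergVatsalCaseOne.exists_finset_bad_not_mem W p
  exact chiBranchLowerLeadingTermAt_of_divisibility_of_padicValRat_j_nonneg p W
    (padicValRat_j_nonneg_of_typeGOrd W p hG)
    (X3Branch.chiBranchLowerDivisibilityAt_of_facts_of_lifting hW16 hGV h23 h414 hGrK S₀ hS₀ hS Φ₀ hΦ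
      heven hnt hram hlift)

/-- **`p ≡ 3 (mod 4)`, additive (G)-ordinary of defect `2`: the ODD `T = 0` LOWER input
`ChiBranchLowerLeadingTermOddAt W p` from PUBLISHED facts + the line data + the displayed lifting** (every twist model is good
ordinary, `TypeGOrd.goodOrd_of_pStar_twist_model`; §2 on the MINUS branch; additive-p2's
`exists_padicInt_constantCoeff_eq_of_iwasawaToPowerSeries_eq_mul_minusBranch`).
[cite: MazurTateTeitelbaum1986Invent, §I.13–I.14] [cite: GreenbergVatsal2000, §3 Thm. (3.12) p. 45]
[cite: Wuthrich2014, Thm. 16 (p. 397)] -/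
theorem ClassX3Gord.chiBranchLowerLeadingTermOddAt_of_facts_of_lifting
    (hW16 : Wuthrich2014.thm16_halfEigenCharIdeal_dvd_cyclotomicPrime)
    (hGV : thm312_branch_unitContent_and_lambda_eq_residual_goodOrd)
    (h23 : datumSelmer_nonPrimitive_invariants)
    (h414 : Greenberg1999.prop414_noFiniteSubmodule_of_not_dvd_torsionOrder)
    (hGrK : Greenberg1999.imKummer_ge_strictCondition_goodOrdinary)
    (hG : TypeGOrd W p) (hadd : Addv W p) (he : semistabilityIndex W p = 2)
    (Φ₀ : AddSubgroup (W.geomTorsion (p : ℤ))) (hΦ : IsRationalLine W p Φ₀)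
    (heven : LineEven W p Φ₀)
    (hnt : ∃ (σ : absoluteGaloisGroup ℚ) (P : W.geomTorsion (p : ℤ)), P ∈ Φ₀ ∧ σ • P ≠ P)
    (hram : ∀ (K : Type) [Field K] [NumberField K] [(galRange (K := ℚ) K).Normal],
      Module.finrank ℚ K = 2 → (∃ θ : K, θ ^ 2 = algebraMap ℚ K ((-1) ^ (p / 2) * p)) →
      ¬ ∀ v : HeightOneSpectrum (𝓞 ℚ), ((p : ℕ) : 𝓞 ℚ) ∈ v.asIdeal →
        ∀ 𝔓 ∈ v.primesAbove, ∀ σ ∈ 𝔓.inertia (absoluteGaloisGroup ℚ), ∀ P ∈ Φ₀,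
          σ • P = (if σ ∈ galRange (K := ℚ) K then P else -P))
    (hlift : ∀ (κ : ZpExtension ℚ p) (S₀ : Finset (HeightOneSpectrum (𝓞 ℚ))), κ.IsCyclotomic →
      (∀ v ∈ S₀, ((p : ℕ) : 𝓞 ℚ) ∉ v.asIdeal) →
      (∀ v : HeightOneSpectrum (𝓞 ℚ), v ∉ S₀ → ((p : ℕ) : 𝓞 ℚ) ∉ v.asIdeal → W.HasGoodReductionAt v) →
      ∀ s ∈ residualQuotSelmer W p κ S₀ Φ₀ hΦ, ∃ x ∈ residualTorsionH1 W p κ S₀,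
        residualEpsilon W p κ Φ₀ hΦ x = s) :
    ChiBranchLowerLeadingTermOddAt W p := by
  obtain ⟨S₀, hS₀, hS⟩ := X2.GreenbergVatsalCaseOne.exists_finset_bad_not_mem W p
  intro V _ _ κ γ N _ f hp3 hCW hred hκ hγ hcv hf D ϖ hϖ g hg
  have hp2 : p ≠ 2 := by omega
  have hodd : ¬ Even (p / 2) := by rw [Nat.not_even_iff_odd]; exact ⟨p / 4, by omega⟩
  obtain ⟨C, hC⟩ := hCW
  have hC' : C • V.quadraticTwist ((-1) ^ (p / 2) * p : ℚ) = W := by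
    rw [pStar_eq_neg_of_mod_four_eq_three hp3]; exact hC
  have hgood : GoodOrd V p := TypeGOrd.goodOrd_of_pStar_twist_model hp2 hG hadd he ⟨C, hC'⟩
  have hord : IsOrdinaryAt V p := (isOrdinaryAt_iff V p).mpr ⟨hgood.1, hgood.2⟩
  obtain ⟨-, g', hchar, u, hι⟩ := X3Branch.charIdeal_eq_span_of_facts_of_lifting hW16 hGV h23 h414 hGrK
    hp2 hgood hC' S₀ hS₀ hS Φ₀ hΦ heven hnt hram hlift hκ hγ hcv hf D ϖ (by rw [if_neg hodd]; exact hϖ)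
  rw [if_neg hodd] at hι
  have hg' : g ∈ Ideal.span ({g'} : Set (IwasawaAlgebra p)) := by rw [← hchar]; exact hg
  obtain ⟨a, rfl⟩ := Ideal.mem_span_singleton'.mp hg'
  have hCu : PowerSeries.C ((((u : ℤ_[p]) : ℚ_[p])) * (ϖ : ℚ_[p])) =
      PowerSeries.C (((u : ℤ_[p]) : ℚ_[p])) * PowerSeries.C (ϖ : ℚ_[p]) := map_mul _ _ _
  have hιg : iwasawaToPowerSeries p (a * g') =
      iwasawaToPowerSeries p (PowerSeries.C (u : ℤ_[p]) * a) *
        (PowerSeries.C ((ϖ : ℚ) : ℚ_[p]) *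
          padicLFunctionMinusBranch f (unitRoot V p : ℚ_[p]) (p / 2)) := by
    rw [map_mul, hι, iwasawaToPowerSeries_C_mul', hCu]
    ring
  exact exists_padicInt_constantCoeff_eq_of_iwasawaToPowerSeries_eq_mul_minusBranch p hp2 V hord hf hιg

/-- **X3♯(G-ord) ∩ `I₀*` (`e = 2`), every odd `p`: the cyclotomic `T = 0` LOWER input
`CycLowerLeadingTermAt W p`** ("for every generator `f` of `char_Λ X(E/ℚ_∞)`, `L(E,1)/Ω_E ∣ f(0)`")
**from PUBLISHED facts + the line data + the displayed lifting** (Birch + Pal transport). Rank-free;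
every odd `p`, `p = 3` INCLUDED (no ramification hypothesis on `Φ₀`).
[cite: Pal2012, Thm. 3.2] [cite: MazurTateTeitelbaum1986Invent, §I.13–I.14]
[cite: GreenbergVatsal2000, §3 Thm. (3.12) p. 45] [cite: Wuthrich2014, Thm. 16 (p. 397)] -/
theorem ClassX3Gord.cycLowerLeadingTermAt_of_facts_of_lifting
    (hW16 : Wuthrich2014.thm16_halfEigenCharIdeal_dvd_cyclotomicPrime)
    (hGV : thm312_branch_unitContent_and_lambda_eq_residual_goodOrd)
    (h23 : datumSelmer_nonPrimitive_invariants)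
    (h414 : Greenberg1999.prop414_noFiniteSubmodule_of_not_dvd_torsionOrder)
    (hGrK : Greenberg1999.imKummer_ge_strictCondition_goodOrdinary)
    (hmod : hasEntireLFunction_rat) (hmodD : nonempty_modularParametrizationData)
    (hX : ClassX3Gord W p) (hp2 : p ≠ 2) (he : semistabilityIndex W p = 2)
    (Φ₀ : AddSubgroup (W.geomTorsion (p : ℤ))) (hΦ : IsRationalLine W p Φ₀)
    (heven : LineEven W p Φ₀)
    (hnt : ∃ (σ : absoluteGaloisGroup ℚ) (P : W.geomTorsion (p : ℤ)), P ∈ Φ₀ ∧ σ • P ≠ P)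
    (hram : ∀ (K : Type) [Field K] [NumberField K] [(galRange (K := ℚ) K).Normal],
      Module.finrank ℚ K = 2 → (∃ θ : K, θ ^ 2 = algebraMap ℚ K ((-1) ^ (p / 2) * p)) →
      ¬ ∀ v : HeightOneSpectrum (𝓞 ℚ), ((p : ℕ) : 𝓞 ℚ) ∈ v.asIdeal →
        ∀ 𝔓 ∈ v.primesAbove, ∀ σ ∈ 𝔓.inertia (absoluteGaloisGroup ℚ), ∀ P ∈ Φ₀,
          σ • P = (if σ ∈ galRange (K := ℚ) K then P else -P))
    (hlift : ∀ (κ : ZpExtension ℚ p) (S₀ : Finset (HeightOneSpectrum (𝓞 ℚ))), κ.IsCyclotomic →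
      (∀ v ∈ S₀, ((p : ℕ) : 𝓞 ℚ) ∉ v.asIdeal) →
      (∀ v : HeightOneSpectrum (𝓞 ℚ), v ∉ S₀ → ((p : ℕ) : 𝓞 ℚ) ∉ v.asIdeal → W.HasGoodReductionAt v) →
      ∀ s ∈ residualQuotSelmer W p κ S₀ Φ₀ hΦ, ∃ x ∈ residualTorsionH1 W p κ S₀,
        residualEpsilon W p κ Φ₀ hΦ x = s) :
    CycLowerLeadingTermAt W p := by
  have hodd := hp.out.eq_two_or_odd'
  by_cases hp4 : p % 4 = 1
  · exact (cycLowerLeadingTermAt_iff_chiBranchLower_of_typeGOrd_of_semistabilityIndex_eq_two W p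
      pal2012_thm32_sqrt_mul_realPeriodRat_twist_eq_of_prime_one_mod_four_holds hmod hmodD hp4 hX.addv
      hX.typeGOrd he).mpr
      (ClassX3Gord.chiBranchLowerLeadingTermAt_of_facts_of_lifting hW16 hGV h23 h414 hGrK hX.typeGOrd Φ₀
        hΦ heven hnt hram hlift)
  · have hp4' : p % 4 = 3 := by
      rcases hodd with h | h
      · exact absurd h hp2
      · obtain ⟨k, hk⟩ := h; omega
    exact (cycLowerLeadingTermAt_iff_chiBranchLowerOdd_of_typeGOrd_of_semistabilityIndex_eq_two W p
      hmod hmodD hp4' hX.addv hX.typeGOrd he).mpr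
      (ClassX3Gord.chiBranchLowerLeadingTermOddAt_of_facts_of_lifting hW16 hGV h23 h414 hGrK hX.typeGOrd
        hX.addv he Φ₀ hΦ heven hnt hram hlift)

end EndStateLifting

/-! ### `p = 3`: the non-degenerate (G-ord, `e = 2`) rows from PUBLISHED facts + the displayed lifting -/

section Three

variable {W : WeierstrassCurve ℚ} [W.IsElliptic] [W.IsGloballyMinimal]

/-- **X3♯(G-ord) at `3`, `r_an = 0`, non-CM, OFF the anomalous and degenerate rows, on the
branch-parity line position: `Typed.MissingLowerBoundAt W 3` FROM PUBLISHED FACTS + the per-pair line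
datum `Φ₀` (rational, EVEN, non-trivial `Γ_ℚ`-action, `χ_{−3}`-twist ramified at `3`) + the
DISPLAYED residual lifting `hlift`** (GV p. 28 with p. 30; on these rows `Φ₀` is UNRAMIFIED at `3`, so
the tree's reading-fact `residualEpsilon_surjOn_of_lineRamifiedEven` does not serve — the same
printed argument, which uses only the evenness of `φ`, is the input to be recorded). Records: `hW16`,
`hGV`, `h23`, `h414`, `hGrK`, `hDel3`, `hGZK`, `hmod`, `hmodD`. Nothing booked.
[cite: Delbourgo2002, Theorem (A), (B) (p. 40)] [cite: GreenbergVatsal2000, §2 (11), (16), pp. 28–30, §3 Thm. (3.12) p. 45]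
[cite: Wuthrich2014, Thm. 16 (p. 397)] [cite: GreenbergLNM1716, Props. 2.2, 2.4, 4.14] [cite: Miller2011LMS, Def. 1.1] -/
theorem ClassX3Gord.missingLowerBoundAt_three_rankZero_of_facts_of_lifting_of_nonAnomalous
    [hp : Fact (Nat.Prime 3)]
    (hW16 : Wuthrich2014.thm16_halfEigenCharIdeal_dvd_cyclotomicPrime)
    (hGV : thm312_branch_unitContent_and_lambda_eq_residual_goodOrd)
    (h23 : datumSelmer_nonPrimitive_invariants)
    (h414 : Greenberg1999.prop414_noFiniteSubmodule_of_not_dvd_torsionOrder)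
    (hGrK : Greenberg1999.imKummer_ge_strictCondition_goodOrdinary)
    (hDel3 : Delbourgo2002.mainTheorem_three)
    (hGZK : rank_eq_analyticRank_of_analyticRank_le_one) (hmod : hasEntireLFunction_rat)
    (hmodD : nonempty_modularParametrizationData)
    (hX : ClassX3Gord W 3) (hcm : ¬ W.HasCM) (hr : W.analyticRank = 0)
    (hna : Delbourgo2002.ReductionNonAnomalous W 3)
    (Φ₀ : AddSubgroup (W.geomTorsion ((3 : ℕ) : ℤ))) (hΦ : IsRationalLine W 3 Φ₀)
    (heven : LineEven W 3 Φ₀)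
    (hnt : ∃ (σ : absoluteGaloisGroup ℚ) (P : W.geomTorsion ((3 : ℕ) : ℤ)), P ∈ Φ₀ ∧ σ • P ≠ P)
    (hram : ∀ (K : Type) [Field K] [NumberField K] [(galRange (K := ℚ) K).Normal],
      Module.finrank ℚ K = 2 →
      (∃ θ : K, θ ^ 2 = algebraMap ℚ K ((-1) ^ ((3 : ℕ) / 2) * (3 : ℕ))) →
      ¬ ∀ v : HeightOneSpectrum (𝓞 ℚ), (((3 : ℕ) : ℕ) : 𝓞 ℚ) ∈ v.asIdeal →
        ∀ 𝔓 ∈ v.primesAbove, ∀ σ ∈ 𝔓.inertia (absoluteGaloisGroup ℚ), ∀ P ∈ Φ₀,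
          σ • P = (if σ ∈ galRange (K := ℚ) K then P else -P))
    (hlift : ∀ (κ : ZpExtension ℚ 3) (S₀ : Finset (HeightOneSpectrum (𝓞 ℚ))), κ.IsCyclotomic →
      (∀ v ∈ S₀, (((3 : ℕ) : ℕ) : 𝓞 ℚ) ∉ v.asIdeal) →
      (∀ v : HeightOneSpectrum (𝓞 ℚ), v ∉ S₀ → (((3 : ℕ) : ℕ) : 𝓞 ℚ) ∉ v.asIdeal →
        W.HasGoodReductionAt v) →
      ∀ s ∈ residualQuotSelmer W 3 κ S₀ Φ₀ hΦ, ∃ x ∈ residualTorsionH1 W 3 κ S₀,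
        residualEpsilon W 3 κ Φ₀ hΦ x = s) :
    MissingLowerBoundAt W 3 :=
  ClassX3Gord.missingLowerBoundAt_three_rankZero_of_cycLower_of_nonAnomalous hDel3 hGZK hmod hX hcm hr
    hna
    (ClassX3Gord.cycLowerLeadingTermAt_of_facts_of_lifting hW16 hGV h23 h414 hGrK hmod hmodD hX
      (by norm_num) (semistabilityIndex_eq_two_of_typeG_three W hX.typeGOrd.typeG hX.addv) Φ₀ hΦ heven
      hnt hram hlift)

/-- **X3♯(G-ord) at `3`, `r_an = 0`, non-CM, OFF the anomalous and degenerate rows, on the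
branch-parity line position: Miller's `BSD(E,3)` FROM PUBLISHED FACTS + the per-pair line datum + the
DISPLAYED residual lifting** (lower: Delbourgo 2002 at `3`; upper: the minus-eigen Wuthrich chain at
`3`, derived from `hW16`, with Delbourgo 1998 Prop. 4). No image / Tamagawa / Manin / `#Ш_an`
hypothesis. Nothing booked. [cite: Delbourgo2002, Theorem (A), (B) (p. 40)]
[cite: Delbourgo1998, Prop. 4 (p. 144)] [cite: Wuthrich2014, Thm. 16 (p. 397)]
[cite: GreenbergVatsal2000, §2 (11), (16), pp. 28–30, §3 Thm. (3.12) p. 45] [cite: Miller2011LMS, §1 and Def. 1.1] -/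
theorem ClassX3Gord.bsdp_three_rankZero_of_facts_of_lifting_of_nonAnomalous
    [hp : Fact (Nat.Prime 3)]
    (hW16 : Wuthrich2014.thm16_halfEigenCharIdeal_dvd_cyclotomicPrime)
    (hGV : thm312_branch_unitContent_and_lambda_eq_residual_goodOrd)
    (h23 : datumSelmer_nonPrimitive_invariants)
    (h414 : Greenberg1999.prop414_noFiniteSubmodule_of_not_dvd_torsionOrder)
    (hGrK : Greenberg1999.imKummer_ge_strictCondition_goodOrdinary)
    (hDel3 : Delbourgo2002.mainTheorem_three)
    (hDel98 : Delbourgo1998.prop4_rankZero_pow_dvd_constantCoeff)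
    (hGZK : rank_eq_analyticRank_of_analyticRank_le_one) (hmod : hasEntireLFunction_rat)
    (hmodD : nonempty_modularParametrizationData)
    (hX : ClassX3Gord W 3) (hcm : ¬ W.HasCM) (hr : W.analyticRank = 0)
    (hna : Delbourgo2002.ReductionNonAnomalous W 3)
    (Φ₀ : AddSubgroup (W.geomTorsion ((3 : ℕ) : ℤ))) (hΦ : IsRationalLine W 3 Φ₀)
    (heven : LineEven W 3 Φ₀)
    (hnt : ∃ (σ : absoluteGaloisGroup ℚ) (P : W.geomTorsion ((3 : ℕ) : ℤ)), P ∈ Φ₀ ∧ σ • P ≠ P)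
    (hram : ∀ (K : Type) [Field K] [NumberField K] [(galRange (K := ℚ) K).Normal],
      Module.finrank ℚ K = 2 →
      (∃ θ : K, θ ^ 2 = algebraMap ℚ K ((-1) ^ ((3 : ℕ) / 2) * (3 : ℕ))) →
      ¬ ∀ v : HeightOneSpectrum (𝓞 ℚ), (((3 : ℕ) : ℕ) : 𝓞 ℚ) ∈ v.asIdeal →
        ∀ 𝔓 ∈ v.primesAbove, ∀ σ ∈ 𝔓.inertia (absoluteGaloisGroup ℚ), ∀ P ∈ Φ₀,
          σ • P = (if σ ∈ galRange (K := ℚ) K then P else -P))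
    (hlift : ∀ (κ : ZpExtension ℚ 3) (S₀ : Finset (HeightOneSpectrum (𝓞 ℚ))), κ.IsCyclotomic →
      (∀ v ∈ S₀, (((3 : ℕ) : ℕ) : 𝓞 ℚ) ∉ v.asIdeal) →
      (∀ v : HeightOneSpectrum (𝓞 ℚ), v ∉ S₀ → (((3 : ℕ) : ℕ) : 𝓞 ℚ) ∉ v.asIdeal →
        W.HasGoodReductionAt v) →
      ∀ s ∈ residualQuotSelmer W 3 κ S₀ Φ₀ hΦ, ∃ x ∈ residualTorsionH1 W 3 κ S₀,
        residualEpsilon W 3 κ Φ₀ hΦ x = s) :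
    BSDp W 3 :=
  ClassX3Gord.bsdp_three_rankZero_of_cycLower_of_nonAnomalous hDel3
    (thm16_minusEigenCharIdeal_dvd_cyclotomicThree_of_half hW16) hDel98 hGZK hmod hmodD hX hcm hr hna
    (ClassX3Gord.cycLowerLeadingTermAt_of_facts_of_lifting hW16 hGV h23 h414 hGrK hmod hmodD hX
      (by norm_num) (semistabilityIndex_eq_two_of_typeG_three W hX.typeGOrd.typeG hX.addv) Φ₀ hΦ heven
      hnt hram hlift)

end Three

end Summit.BirchSwinnertonDyer.Rank1Residual.Additive

end
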